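import Summits.ValiantsHypothesis.ValiantsHypothesis.Theorems.ValuativeGCTValuativeFlipDiagonalInheritance
import Summits.ValiantsHypothesis.ValiantsHypothesis.Theorems.ValuativeGCTValuativeFlipPaddedPerNoSmallBodyEquations
import Summits.ValiantsHypothesis.ValiantsHypothesis.Theorems.ValuativeGCTValuativeFlipLiftSurjective
import Summits.ValiantsHypothesis.ValiantsHypothesis.Theorems.ValuativeGCTValuativeFlipStableRay
import HarnessLib

/-!
# The profile of a diagonal `j ↦ mult ℂ[Δ_{m+j}(X₀₀^{m-n} per_{n+j})]`: monotone transient, then the ambient value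
# (crux `ValuativeGCT.ValuativeFlip`, stmt-ValiantsHypothesis-12624; wall-breaker k12, axis
# "representation-stability transfer between `m` and `m + 1`"; helper file `--supports`)

Sequel to `…DiagonalInheritance` (diagonal inheritance `P(n, m, λ) ≤ P(n+j, m+j, λ♯)` at every step).  With
the tree's exact plethysm stability (`plethysmCoeff_rowLift_eq`, `λ₂ ≤ m`) and no-small-body-equations theorem
(`paddedPer_orbitMultiplicity_eq_plethysmCoeff_of_bodySize_le_inner`, k3) every diagonal of the per side of the
flip body is completely described:

* `paddedPer_diag_profile`: `j ↦ P(n+j, m+j, λ♯(m+j))` is non-decreasing at every step, bounded by the CONSTANT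
  ambient value `a_λ(δ[m])`, and EQUAL to it from `j ≥ bodySize λ − n` on — a monotone transient of length at most
  `|λ̄| − n` followed by the ambient value (the determinant side along the same diagonal, `det_everyStepMonotone`,
  reaches `a` already at `j = bodySize λ − m`);
* `per_rowLift_mono`, `per_le_per_rowLift`: the case `n = m` — the PERMANENTS `per_m, per_{m+1}, …` are
  representation-monotone under first-row lifts at every step (twin of `det_everyStepMonotone`);
* `paddedPer_eqFree_mono_order` / `paddedPer_eqn_descends_order`: equation-freeness of `Δ_m(X₀₀^{m-n} per_n)` at
  `(λ*, δ)` is an UP-set for the window order `(n, m) ≼ (n', m')` ("more level, no more padding"), equivalently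
  equations DESCEND along it — with no threshold (contrast the determinant's `det_base_lt_plethysm_of_ray_lt`,
  `j ≥ 2(n+1)^10`): an equation-free cell certified at a small, computable position propagates to every larger one.

Sources: BLMW, SIAM J. Comput. 40 (2011) §4.4, §6.4; Bürgisser–Ikenmeyer–Panova, J. AMS 32 (2019) §5–§6;
Ikenmeyer–Panova 2017 Prop. 2.6; this crux (k3 `…PaddedPerNoSmallBodyEquations`, k4 `…LiftSurjective`).
No new definitions.
-/

set_option linter.dupNamespace false

namespace Summit.ValiantsHypothesis.ValiantsHypothesis.Theorems.ValuativeFlip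

open scoped BigOperators Matrix
open MvPolynomial
open Literature.NumberTheory.DiophantineGeometry
open Literature.Computability.AlgebraicComplexity
open Literature.Computability.Complexity

noncomputable section

/-! ## The profile of a diagonal: monotone transient, then the ambient value -/

/-- **Every diagonal value is bounded by the ambient plethysm coefficient of its own level**
(`mult ≤ a`, complete reducibility). [BLMW 2011 §4.4] -/
theorem paddedPer_diag_le_plethysm {n m : ℕ} (hnm : n ≤ m) (j : ℕ) [NeZero (m + j)]
    (χ : Weight (MatIdx (m + j))) :
    orbitMultiplicity ℂ (paddedPerFormLex ℂ (n + j) (m + j)) (m + j) χ ≤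
      plethysmCoeff ℂ (MatIdx (m + j)) (m + j) χ :=
  orbitMultiplicity_le_plethysmCoeff_holds _ (NeZero.ne (m + j))
    (paddedPerFormLex_isHomogeneous ℂ (by omega)) χ

/-- **The diagonal reaches the ambient value once the inner size passes the body**: for
`n + j ≥ |λ̄|` (= `bodySize λ = bodySize (λ♯)`),
`mult_{(λ♯(m+j))*} ℂ[Δ_{m+j}(X₀₀^{m-n} per_{n+j})] = a_{λ♯(m+j)}(δ[m+j])` (k3's no-small-body-equations
theorem `paddedPer_orbitMultiplicity_eq_plethysmCoeff_of_bodySize_le_inner` at level `m + j`).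
[Bürgisser–Ikenmeyer–Panova 2019 §6; this crux (k3)] -/
theorem paddedPer_diag_eq_plethysm_of_bodySize_le {n m : ℕ} [NeZero m] (hnm : n ≤ m) {δ : ℕ}
    (lam : Nat.Partition (m * δ)) (hlam : lam.parts.card ≤ m * m) (j : ℕ) [NeZero (m + j)]
    (hj : bodySize lam ≤ n + j) :
    orbitMultiplicity ℂ (paddedPerFormLex ℂ (n + j) (m + j)) (m + j)
        (partitionWeightLex (m + j) (rowLift lam j)) =
      plethysmCoeff ℂ (MatIdx (m + j)) (m + j) (partitionWeightLex (m + j) (rowLift lam j)) :=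
  paddedPer_orbitMultiplicity_eq_plethysmCoeff_of_bodySize_le_inner (by omega) (rowLift lam j)
    (card_parts_rowLift_le_sq lam hlam j) (by rwa [bodySize_rowLift])

/-- **The profile of a diagonal** from `(n, m, λ)` (`n ≤ m`, `λ ⊢ m·δ` with at most `m²` parts and
`λ₂ ≤ m`): the sequence `j ↦ P(n+j, m+j, λ♯(m+j)) = mult ℂ[Δ_{m+j}(X₀₀^{m-n} per_{n+j})]` is
(i) non-decreasing at every step (`orbitMultiplicity_paddedPer_diag_mono`), (ii) bounded by the CONSTANT
ambient value `a_λ(δ[m])` (exact plethysm stability `plethysmCoeff_rowLift_eq`), and (iii) EQUAL to it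
from `j ≥ bodySize λ − n` on (no small-body equations).  So every diagonal is a monotone transient of
length at most `bodySize λ − n ≤ m·δ − n` followed by the ambient value; flips seen along a diagonal live
in the transient, where the determinant side `K_{m+j}((λ♯)*)` (also non-decreasing, `det_everyStepMonotone`,
and `= a` already from `j ≥ bodySize λ − m`) has reached `a` first. [this crux] -/
theorem paddedPer_diag_profile {n m : ℕ} [NeZero m] (hnm : n ≤ m) {δ : ℕ}
    (lam : Nat.Partition (m * δ)) (hlam : lam.parts.card ≤ m * m) (h₂ : lam.sortedParts.getD 1 0 ≤ m) :
    (∀ j₁ j₂ : ℕ, j₁ ≤ j₂ → ∀ [NeZero (m + j₁)] [NeZero (m + j₂)],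
        orbitMultiplicity ℂ (paddedPerFormLex ℂ (n + j₁) (m + j₁)) (m + j₁)
            (partitionWeightLex (m + j₁) (rowLift lam j₁)) ≤
          orbitMultiplicity ℂ (paddedPerFormLex ℂ (n + j₂) (m + j₂)) (m + j₂)
            (partitionWeightLex (m + j₂) (rowLift lam j₂))) ∧
    (∀ j : ℕ, ∀ [NeZero (m + j)],
        orbitMultiplicity ℂ (paddedPerFormLex ℂ (n + j) (m + j)) (m + j)
            (partitionWeightLex (m + j) (rowLift lam j)) ≤
          plethysmCoeff ℂ (MatIdx m) m (partitionWeightLex m lam)) ∧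
    (∀ j : ℕ, ∀ [NeZero (m + j)], bodySize lam ≤ n + j →
        orbitMultiplicity ℂ (paddedPerFormLex ℂ (n + j) (m + j)) (m + j)
            (partitionWeightLex (m + j) (rowLift lam j)) =
          plethysmCoeff ℂ (MatIdx m) m (partitionWeightLex m lam)) := by
  refine ⟨fun j₁ j₂ hj _ _ => orbitMultiplicity_paddedPer_diag_mono hnm lam hlam hj, fun j _ => ?_,
    fun j _ hj => ?_⟩
  · rw [← plethysmCoeff_rowLift_eq lam hlam h₂ j]
    exact paddedPer_diag_le_plethysm hnm j _
  · rw [← plethysmCoeff_rowLift_eq lam hlam h₂ j]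
    exact paddedPer_diag_eq_plethysm_of_bodySize_le hnm lam hlam j hj

/-- **The base value is bounded by every later diagonal value and by the ambient**: for all `j`,
`P(n, m, λ) ≤ P(n+j, m+j, λ♯) ≤ a_λ(δ[m])` (`λ₂ ≤ m`); in particular a per-side certificate of size `D`
at `(n, m, λ)` forces `D ≤ a_λ(δ[m])` and is inherited by every `(n+j, m+j, λ♯)`. [this crux] -/
theorem orbitMultiplicity_paddedPer_le_diag_le_plethysm {n m : ℕ} [NeZero m] (hnm : n ≤ m) {δ : ℕ}
    (lam : Nat.Partition (m * δ)) (hlam : lam.parts.card ≤ m * m) (h₂ : lam.sortedParts.getD 1 0 ≤ m)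
    (j : ℕ) [NeZero (m + j)] :
    orbitMultiplicity ℂ (paddedPerFormLex ℂ n m) m (partitionWeightLex m lam) ≤
      orbitMultiplicity ℂ (paddedPerFormLex ℂ (n + j) (m + j)) (m + j)
        (partitionWeightLex (m + j) (rowLift lam j)) ∧
    orbitMultiplicity ℂ (paddedPerFormLex ℂ (n + j) (m + j)) (m + j)
        (partitionWeightLex (m + j) (rowLift lam j)) ≤
      plethysmCoeff ℂ (MatIdx m) m (partitionWeightLex m lam) :=
  ⟨orbitMultiplicity_paddedPer_le_diag hnm lam hlam j,
    (plethysmCoeff_rowLift_eq lam hlam h₂ j) ▸ paddedPer_diag_le_plethysm hnm j _⟩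

/-! ## The permanents themselves, and equation descent along the window order -/

/-- **The permanents are representation-monotone under first-row lifts, at every step.**  For
`λ ⊢ m·δ` with at most `m²` parts and `j₁ ≤ j₂`:
`mult_{(λ♯(m+j₁))*} ℂ[Δ(per_{m+j₁})] ≤ mult_{(λ♯(m+j₂))*} ℂ[Δ(per_{m+j₂})]` (`per_N = paddedPerFormLex ℂ N N`; the
case `n = m` of `orbitMultiplicity_paddedPer_diag_mono`).  The determinant twin is `det_everyStepMonotone`;
so both fundamental sequences `(det_N)_N`, `(per_N)_N` never lose an isotypic component when a box row of
length `δ` is added to the first row and the size goes up by one. [BLMW 2011 §6.4 Problem 6.10; this crux] -/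
theorem per_rowLift_mono {m : ℕ} [NeZero m] {δ : ℕ} (lam : Nat.Partition (m * δ))
    (hlam : lam.parts.card ≤ m * m) {j₁ j₂ : ℕ} (hj : j₁ ≤ j₂) [NeZero (m + j₁)] [NeZero (m + j₂)] :
    orbitMultiplicity ℂ (paddedPerFormLex ℂ (m + j₁) (m + j₁)) (m + j₁)
        (partitionWeightLex (m + j₁) (rowLift lam j₁)) ≤
      orbitMultiplicity ℂ (paddedPerFormLex ℂ (m + j₂) (m + j₂)) (m + j₂)
        (partitionWeightLex (m + j₂) (rowLift lam j₂)) :=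
  orbitMultiplicity_paddedPer_diag_mono le_rfl lam hlam hj

/-- **`per_m` to `per_{m+j}` in one step**: `mult_{λ*} ℂ[Δ(per_m)] ≤ mult_{(λ♯(m+j))*} ℂ[Δ(per_{m+j})]`.
[this crux] -/
theorem per_le_per_rowLift {m : ℕ} [NeZero m] {δ : ℕ} (lam : Nat.Partition (m * δ))
    (hlam : lam.parts.card ≤ m * m) (j : ℕ) [NeZero (m + j)] :
    orbitMultiplicity ℂ (paddedPerFormLex ℂ m m) m (partitionWeightLex m lam) ≤
      orbitMultiplicity ℂ (paddedPerFormLex ℂ (m + j) (m + j)) (m + j)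
        (partitionWeightLex (m + j) (rowLift lam j)) :=
  orbitMultiplicity_paddedPer_le_diag le_rfl lam hlam j

/-- **Equation-freeness is an up-set for the window order.**  If `Δ_m(X₀₀^{m-n} per_n)` has NO equation of
type `λ*` in degree `δ` (`P(n, m, λ) = a_λ(δ[m])`, `λ₂ ≤ m`), then neither has `Δ_{m+j}(X₀₀^{m+j-n'} per_{n'})`
at `(λ♯(m+j))*` for any `n + j ≤ n' ≤ m + j` (order monotonicity + `P ≤ a` + exact plethysm stability).  So an
equation-free cell certified at a SMALL position (where it is computable) propagates to every `≽`-larger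
position. [this crux] -/
theorem paddedPer_eqFree_mono_order {n m n' : ℕ} [NeZero m] (hnm : n ≤ m) {δ : ℕ}
    (lam : Nat.Partition (m * δ)) (hlam : lam.parts.card ≤ m * m) (h₂ : lam.sortedParts.getD 1 0 ≤ m)
    (j : ℕ) [NeZero (m + j)] (hn' : n + j ≤ n') (hn'm : n' ≤ m + j)
    (hfree : orbitMultiplicity ℂ (paddedPerFormLex ℂ n m) m (partitionWeightLex m lam) =
      plethysmCoeff ℂ (MatIdx m) m (partitionWeightLex m lam)) :
    orbitMultiplicity ℂ (paddedPerFormLex ℂ n' (m + j)) (m + j) (partitionWeightLex (m + j) (rowLift lam j)) =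
      plethysmCoeff ℂ (MatIdx (m + j)) (m + j) (partitionWeightLex (m + j) (rowLift lam j)) := by
  refine le_antisymm (orbitMultiplicity_le_plethysmCoeff_holds _ (NeZero.ne (m + j))
    (paddedPerFormLex_isHomogeneous ℂ hn'm) _) ?_
  rw [plethysmCoeff_rowLift_eq lam hlam h₂ j, ← hfree]
  exact orbitMultiplicity_paddedPer_mono_order hnm lam hlam j hn' hn'm

/-- **Equations descend along the window order** (contrapositive): an equation of
`Δ_{m+j}(X₀₀^{m+j-n'} per_{n'})` of type `(λ♯(m+j))*` in degree `δ` (`mult < a`), `n + j ≤ n' ≤ m + j`, `λ₂ ≤ m`,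
forces an equation of `Δ_m(X₀₀^{m-n} per_n)` of type `λ*` in the same degree.  In particular
(`n' = m + j`, `n = m`): an equation of `Δ(per_{m+j})` at `(λ♯)*` descends to an equation of `Δ(per_m)` at `λ*`
— the permanent twin of `det_base_lt_plethysm_of_ray_lt`, with NO threshold on `j`. [this crux] -/
theorem paddedPer_eqn_descends_order {n m n' : ℕ} [NeZero m] (hnm : n ≤ m) {δ : ℕ}
    (lam : Nat.Partition (m * δ)) (hlam : lam.parts.card ≤ m * m) (h₂ : lam.sortedParts.getD 1 0 ≤ m)
    (j : ℕ) [NeZero (m + j)] (hn' : n + j ≤ n') (hn'm : n' ≤ m + j)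
    (heq : orbitMultiplicity ℂ (paddedPerFormLex ℂ n' (m + j)) (m + j) (partitionWeightLex (m + j) (rowLift lam j)) <
      plethysmCoeff ℂ (MatIdx (m + j)) (m + j) (partitionWeightLex (m + j) (rowLift lam j))) :
    orbitMultiplicity ℂ (paddedPerFormLex ℂ n m) m (partitionWeightLex m lam) <
      plethysmCoeff ℂ (MatIdx m) m (partitionWeightLex m lam) := by
  refine lt_of_le_of_ne (orbitMultiplicity_le_plethysmCoeff_holds _ (NeZero.ne m)
    (paddedPerFormLex_isHomogeneous ℂ hnm) _) fun hfree => ?_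
  exact heq.ne (paddedPer_eqFree_mono_order hnm lam hlam h₂ j hn' hn'm hfree)

end

end Summit.ValiantsHypothesis.ValiantsHypothesis.Theorems.ValuativeFlip
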